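import Literature.Geometry.DiscreteGeometry.FejesTothTammesBound

/-!
# The Tammes problem for twelve points: `d₁₂ = √(2 − 2/√5)` (the icosahedron, `63°26′`),
# the sharp case `n = 12` of Fejes Tóth's bound — proved

Topic `Literature/Geometry/DiscreteGeometry`.  Theorem-only companion of
`FejesTothTammesBound.lean` and of the Tammes rows `N = 2, …, 6` of `RankinSimplexBound.lean`.
L. Fejes Tóth 1943 (Jber. DMV 53, p. 66), AS PRINTED: "Es läßt sich zeigen, daß `d_n` sein
Maximum `d̄_n = Max d_n` für `n = 3, 4, 6` und `12` in dem Fall erreicht, bei dem `P₁, P₂, …, P_n`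
die Ecken eines in einem Großkreis einbeschriebenen regulären Dreiecks, eines regulären
Tetraeders, eines Oktaeders bzw. eines Ikosaeders sind" and, after (1)
`d_n ≤ (4 − cosec² ((n/(n−2))·(π/6)))^{1/2}`: "Unsere Ungleichung läßt sich daher für
`n = 3, 4, 6` und `12` nicht verschärfen".

Here the row `n = 12` is made a theorem of the tree:

* `sqrt_le_maxMinDist_twelve` — the regular ICOSAHEDRON as an explicit coefficient table
  (rows `(0, ±a, ±b)`, `(±a, ±b, 0)`, `(±b, 0, ±a)` with `a² = (5 − √5)/10`, `b² = (5 + √5)/10`,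
  so `b/a = φ`, `a² + b² = 1` and `b² − a² = ab = 1/√5`): twelve unit vectors with pairwise
  inner products `≤ 1/√5`, hence `d₁₂ ≥ √(2 − 2/√5)` in every real inner product space of
  dimension `≥ 3` (`sqrt_le_maxMinDist_of_table`);
* `maxMinDist_twelve_le` — Fejes Tóth's bound at `N = 12`: `ω₁₂ = 12π/60 = π/5 = 36°`,
  `cos 36° = (1 + √5)/4` (`Real.cos_pi_div_five`), `cot² 36° = 1 + 2/√5`, so
  `√(3 − cot² ω₁₂) = √(2 − 2/√5)`;
* `maxMinDist_twelve_euclideanSpace_three` — **`d₁₂ = √(2 − 2/√5)`** (`= 1.05146…`, the edge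
  of the icosahedron inscribed in the unit sphere; angular `arccos (1/√5) = 63°26′`), and
  `maxMinDist_twelve_eq_sqrt_three_sub_cot_sq` — **equality in (1) at `n = 12`**, as printed;
  `maxMinDist_twelve_mem_Ioo` — the decimal bracket `1.0514 < d₁₂ < 1.0515`;
  `exists_dist_le_of_twelve_le_card` — the finite-set reading.

Everything is proved; no named facts.  Not here: the uniqueness of the icosahedral arrangement
and the row `n = 11` (`d₁₁ = d₁₂`, Danzer/Böröczky).

## References
* L. Fejes [Tóth], *Über eine Abschätzung des kürzesten Abstandes zweier Punkte eines auf einer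
  Kugelfläche liegenden Punktsystems*, Jber. Deutsch. Math.-Verein. 53 (1943) 66–68, p. 66
  and (1). [`FejesToth1943Tammes`]
* H. T. Croft, K. J. Falconer, R. K. Guy, *Unsolved Problems in Geometry* (1991), §D7, table
  (`12 | 63°26′ | icosahedron`). [`CroftFalconerGuy1991`]
-/

noncomputable section

namespace Literature.Geometry.DiscreteGeometry

open RealInnerProductSpace Module Finset Real

universe u

/-! ### The constants `√5`, `a = √((5 − √5)/10)`, `b = √((5 + √5)/10)` -/

/-- `√5 · √5 = 5`. [folklore] -/
private theorem sqrt_five_mul_self : Real.sqrt 5 * Real.sqrt 5 = 5 :=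
  Real.mul_self_sqrt (by norm_num)

/-- `2 < √5`. [folklore] -/
private theorem two_lt_sqrt_five : (2 : ℝ) < Real.sqrt 5 :=
  (Real.lt_sqrt (by norm_num)).2 (by norm_num)

/-- `√5 < 3`. [folklore] -/
private theorem sqrt_five_lt_three : Real.sqrt 5 < 3 :=
  (Real.sqrt_lt' (by norm_num)).2 (by norm_num)

/-- `a² = (5 − √5)/10`. [folklore] -/
private theorem icosA_mul_self :
    Real.sqrt ((5 - Real.sqrt 5) / 10) * Real.sqrt ((5 - Real.sqrt 5) / 10) =
      (5 - Real.sqrt 5) / 10 :=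
  Real.mul_self_sqrt (by linarith [sqrt_five_lt_three])

/-- `b² = (5 + √5)/10`. [folklore] -/
private theorem icosB_mul_self :
    Real.sqrt ((5 + Real.sqrt 5) / 10) * Real.sqrt ((5 + Real.sqrt 5) / 10) =
      (5 + Real.sqrt 5) / 10 :=
  Real.mul_self_sqrt (by positivity)

/-- `ab = √5/5 = 1/√5`. [folklore] -/
private theorem icosA_mul_icosB :
    Real.sqrt ((5 - Real.sqrt 5) / 10) * Real.sqrt ((5 + Real.sqrt 5) / 10) = Real.sqrt 5 / 5 := by
  rw [← Real.sqrt_mul (by linarith [sqrt_five_lt_three]),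
    show (5 - Real.sqrt 5) / 10 * ((5 + Real.sqrt 5) / 10) = (Real.sqrt 5 / 5) ^ 2 by
      linear_combination (-(1 : ℝ) / 20) * sqrt_five_mul_self]
  exact Real.sqrt_sq (by positivity)

/-! ### The icosahedron: `d₁₂ ≥ √(2 − 2/√5)` -/

section Icosahedron

variable {E : Type u} [NormedAddCommGroup E] [InnerProductSpace ℝ E]

set_option maxHeartbeats 800000 in
/-- **The regular icosahedron**: the twelve unit vectors `(0, ±a, ±b)`, `(±a, ±b, 0)`,
`(±b, 0, ±a)` (`a² = (5 − √5)/10`, `b² = (5 + √5)/10`, `b/a = φ`) over an orthonormal frame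
have pairwise inner products `∈ {1/√5, −1/√5, −1}`, all `≤ 1/√5`; hence
`d₁₂ ≥ √(2 − 2/√5)` in every real inner product space of dimension `≥ 3` ("für `n = 12` in dem
Fall erreicht, bei dem `P₁, …, P_n` die Ecken eines Ikosaeders sind").
[cite: FejesToth1943Tammes, p. 66 (n = 12: Ikosaeder)]
[cite: CroftFalconerGuy1991, §D7 table (12 | 63°26′ | icosahedron)] -/
theorem sqrt_le_maxMinDist_twelve [FiniteDimensional ℝ E] (h3 : 3 ≤ finrank ℝ E) :
    Real.sqrt (2 - 2 * (Real.sqrt 5 / 5)) ≤ maxMinDist 12 E := by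
  set a := Real.sqrt ((5 - Real.sqrt 5) / 10) with ha_def
  set b := Real.sqrt ((5 + Real.sqrt 5) / 10) with hb_def
  have ha : a * a = (5 - Real.sqrt 5) / 10 := icosA_mul_self
  have hb : b * b = (5 + Real.sqrt 5) / 10 := icosB_mul_self
  have hab : a * b = Real.sqrt 5 / 5 := icosA_mul_icosB
  have h2 := two_lt_sqrt_five
  exact sqrt_le_maxMinDist_of_table (E := E) h3 (by norm_num : 2 ≤ 12)
    ![![0, a, b], ![0, a, -b], ![0, -a, b], ![0, -a, -b],
      ![a, b, 0], ![a, -b, 0], ![-a, b, 0], ![-a, -b, 0],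
      ![b, 0, a], ![-b, 0, a], ![b, 0, -a], ![-b, 0, -a]] (Real.sqrt 5 / 5)
    (fun k => by fin_cases k <;> simp [Fin.sum_univ_three] <;> linarith [ha, hb])
    (fun k l hkl => by
      fin_cases k <;> fin_cases l <;>
        first
        | exact absurd rfl hkl
        | simp [Fin.sum_univ_three]; linarith [ha, hb, hab, h2])

end Icosahedron

/-! ### Fejes Tóth's bound at `N = 12` and the value `d₁₂` -/

/-- `3 − cot² 36° = 2 − 2/√5` (`cos 36° = (1 + √5)/4`, `sin² 36° = (5 − √5)/8`,
`cot² 36° = (3 + √5)/(5 − √5) = 1 + 2/√5`). [folklore] -/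
private theorem three_sub_cot_sq_pi_div_five :
    3 - Real.cot (π / 5) ^ 2 = 2 - 2 * (Real.sqrt 5 / 5) := by
  have hs := sqrt_five_mul_self
  have h3 := sqrt_five_lt_three
  have hcos : Real.cos (π / 5) ^ 2 = (3 + Real.sqrt 5) / 8 := by
    rw [Real.cos_pi_div_five]; linear_combination (1 / 16 : ℝ) * hs
  have hsin : Real.sin (π / 5) ^ 2 = (5 - Real.sqrt 5) / 8 := by
    rw [Real.sin_sq, hcos]; ring
  have hq : (3 + Real.sqrt 5) / 8 / ((5 - Real.sqrt 5) / 8) = 1 + 2 * (Real.sqrt 5 / 5) := by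
    rw [div_eq_iff (ne_of_gt (by linarith : (0 : ℝ) < (5 - Real.sqrt 5) / 8))]
    linear_combination (1 / 20 : ℝ) * hs
  rw [Real.cot_eq_cos_div_sin, div_pow, hcos, hsin, hq]
  ring

/-- **Fejes Tóth's bound at `N = 12`**: `ω₁₂ = 12π/(6·10) = π/5 = 36°` and
`√(3 − cot² 36°) = √(2 − 2/√5)`, so `d₁₂ ≤ √(2 − 2/√5)`.
[cite: FejesToth1943Tammes, (1) p. 66, n = 12] -/
theorem maxMinDist_twelve_le :
    maxMinDist 12 (EuclideanSpace ℝ (Fin 3)) ≤ Real.sqrt (2 - 2 * (Real.sqrt 5 / 5)) := by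
  have h := maxMinDist_le_fejesToth (N := 12) (by norm_num)
  rwa [show ((12 : ℕ) : ℝ) * π / (6 * ((12 : ℕ) - 2)) = π / 5 by push_cast; ring,
    three_sub_cot_sq_pi_div_five] at h

/-- **The Tammes problem for twelve points: `d₁₂ = √(2 − 2/√5)`** (`= 1.05146…`, the edge of the
regular icosahedron inscribed in the unit sphere; angular `arccos (1/√5) = 63°26′`) — Fejes
Tóth's bound is attained by the icosahedron. [cite: FejesToth1943Tammes, p. 66 (n = 12) and (1)]
[cite: CroftFalconerGuy1991, §D7 table (12 | 63°26′ | icosahedron)] -/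
theorem maxMinDist_twelve_euclideanSpace_three :
    maxMinDist 12 (EuclideanSpace ℝ (Fin 3)) = Real.sqrt (2 - 2 * (Real.sqrt 5 / 5)) :=
  le_antisymm maxMinDist_twelve_le (sqrt_le_maxMinDist_twelve (by rw [finrank_euclideanSpace_fin]))

/-- **Equality in Fejes Tóth's (1) at `n = 12`** ("Unsere Ungleichung läßt sich daher für
`n = 3, 4, 6` und `12` nicht verschärfen"): `d₁₂ = √(3 − cot² (π/5))`, `π/5 = 12π/(6(12 − 2))`.
[cite: FejesToth1943Tammes, p. 66, the sentence after (1)] -/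
theorem maxMinDist_twelve_eq_sqrt_three_sub_cot_sq :
    maxMinDist 12 (EuclideanSpace ℝ (Fin 3)) = Real.sqrt (3 - Real.cot (π / 5) ^ 2) := by
  rw [three_sub_cot_sq_pi_div_five, maxMinDist_twelve_euclideanSpace_three]

/-- The decimal bracket **`1.0514 < d₁₂ < 1.0515`** (`2.236 < √5 < 2.2361`).
[cite: CroftFalconerGuy1991, §D7 table (12 | 63°26′)] -/
theorem maxMinDist_twelve_mem_Ioo :
    maxMinDist 12 (EuclideanSpace ℝ (Fin 3)) ∈ Set.Ioo (1.0514 : ℝ) 1.0515 := by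
  rw [maxMinDist_twelve_euclideanSpace_three]
  have hlo : (2.236 : ℝ) < Real.sqrt 5 := (Real.lt_sqrt (by norm_num)).2 (by norm_num)
  have hhi : Real.sqrt 5 < 2.2361 := (Real.sqrt_lt' (by norm_num)).2 (by norm_num)
  constructor
  · exact (Real.lt_sqrt (by norm_num)).2 (by linarith)
  · exact (Real.sqrt_lt' (by norm_num)).2 (by linarith)

/-- Hence `ψ(x) ≤ √(2 − 2/√5)` for every arrangement of twelve unit vectors of `ℝ³`: **among any
twelve points of `S²` two are at angular distance `≤ 63°26′`**, with equality for the
icosahedron. [cite: FejesToth1943Tammes, p. 66 (n = 12) and (1)] -/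
theorem minDist_twelve_le {x : Fin 12 → EuclideanSpace ℝ (Fin 3)}
    (hx : x ∈ unitConfigs 12 (EuclideanSpace ℝ (Fin 3))) :
    minDist x ≤ Real.sqrt (2 - 2 * (Real.sqrt 5 / 5)) :=
  (minDist_le_maxMinDist hx).trans_eq maxMinDist_twelve_euclideanSpace_three

/-- **Finite-set reading**: a finite set of at least twelve points of the unit sphere of `ℝ³`
contains two distinct points at distance `≤ √(2 − 2/√5) < 1.0515`.
[cite: FejesToth1943Tammes, p. 66 (n = 12) and (1)] -/
theorem exists_dist_le_of_twelve_le_card {T : Finset (EuclideanSpace ℝ (Fin 3))}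
    (hT : ∀ v ∈ T, ‖v‖ = 1) (h12 : 12 ≤ T.card) :
    ∃ v ∈ T, ∃ w ∈ T, v ≠ w ∧ dist v w ≤ Real.sqrt (2 - 2 * (Real.sqrt 5 / 5)) := by
  obtain ⟨S, hST, hS⟩ := Finset.exists_subset_card_eq h12
  obtain ⟨v, hv, w, hw, hne, hd⟩ :=
    exists_dist_le_maxMinDist (T := S) (fun v hv => hT v (hST hv)) (by omega)
  rw [hS, maxMinDist_twelve_euclideanSpace_three] at hd
  exact ⟨v, hST hv, w, hST hw, hne, hd⟩

end Literature.Geometry.DiscreteGeometry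

end
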